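import Summits.SmoothPoincare4.SmoothPoincare4.Theorems.SymplecticOrigamiGromovRecognitionRelEndStubCapModelAux3
import Mathlib.Geometry.Manifold.LocalDiffeomorph

/-!
# Reading the bi-foliation chart `σ` — the inverse of an injective local diffeomorphism
(stub `stub_readSigma` of line `cross-cap-laurent`, crux `SymplecticOrigami.GromovRecognitionRelEnd`,
item stmt-SmoothPoincare4-11009; first auxiliary file, generic)

The cap charts `ηH`, `ηV` of the wedge cap are injective `C^∞` local diffeomorphisms on open
polydiscs `D ⊆ ℝ⁴`; the chart `σ` of the stub reads points of `X` back in these charts through the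
inverse `θ = (η|D)⁻¹ : X → ℝ⁴`.  This file is the generic calculus of such an inverse
`Function.invFunOn f s` for `f` an injective local diffeomorphism on an open set `s`
(Lee 2013, Thm. 4.5 / Prop. 4.22 pattern, here purely formal from Mathlib's `IsLocalDiffeomorphAt`
API): near `f p` it agrees with the chosen local inverse (`invFunOn_eventuallyEq_localInverse`),
hence is `C^n` there (`contMDiffAt_invFunOn`), its differential inverts `df_p`
(`mfderiv_invFunOn_apply_mfderiv`, `mfderiv_apply_mfderiv_invFunOn`), is injective, and
intertwines endomorphisms intertwined by `df_p` (`mfderiv_invFunOn_conj`: if `f` is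
`(I₀, J)`-holomorphic at `p` then `θ` is `(J, I₀)`-holomorphic at `f p`).  Also: the two coordinate
projections `T01`, `T23 : ℝ⁴ → ℝ²` used to read the labels.
-/

noncomputable section

-- the registered namespace `Summit.SmoothPoincare4.SmoothPoincare4.Theorems…` repeats a component
set_option linter.dupNamespace false

open scoped Manifold ContDiff Topology
open Set Function Filter

namespace Summit.SmoothPoincare4.SmoothPoincare4.Theorems.GromovRecognitionRelEnd.CrossCapLaurent

namespace ReadSigma

/-! ## The inverse of an injective local diffeomorphism on an open set -/

section LocInv

variable {E : Type*} [NormedAddCommGroup E] [NormedSpace ℝ E] {H : Type*} [TopologicalSpace H]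
  {I : ModelWithCorners ℝ E H} {A : Type*} [TopologicalSpace A] [ChartedSpace H A] [Nonempty A]
  {E' : Type*} [NormedAddCommGroup E'] [NormedSpace ℝ E'] {H' : Type*} [TopologicalSpace H']
  {I' : ModelWithCorners ℝ E' H'} {N : Type*} [TopologicalSpace N] [ChartedSpace H' N]
  {n : WithTop ℕ∞} {f : A → N} {s : Set A}

omit [TopologicalSpace A] [TopologicalSpace N] in
/-- On `s`, `invFunOn f s ∘ f = id` for `f` injective on `s`. [folklore] -/
theorem invFunOn_apply_of_mem (hinj : InjOn f s) {p : A} (hp : p ∈ s) : invFunOn f s (f p) = p :=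
  hinj.leftInvOn_invFunOn hp

omit [TopologicalSpace A] [TopologicalSpace N] in
/-- On `f '' s`, `f ∘ invFunOn f s = id` and the inverse lands in `s`. [folklore] -/
theorem invFunOn_spec {y : N} (hy : y ∈ f '' s) : invFunOn f s y ∈ s ∧ f (invFunOn f s y) = y := by
  obtain ⟨p, hp, rfl⟩ := hy
  exact invFunOn_pos ⟨p, hp, rfl⟩

/-- **Near `f p` the set-theoretic inverse is the chosen smooth local inverse** of the local
diffeomorphism `f` (on the open set where the local inverse lands in `s`). [folklore] -/
theorem invFunOn_eventuallyEq_localInverse (hf : IsLocalDiffeomorphOn I I' n f s) (hs : IsOpen s)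
    (hinj : InjOn f s) {p : A} (hp : p ∈ s) :
    invFunOn f s =ᶠ[𝓝 (f p)] (hf ⟨p, hp⟩).localInverse := by
  have hf' : IsLocalDiffeomorphAt I I' n f p := hf ⟨p, hp⟩
  have hcont : ContinuousOn hf'.localInverse hf'.localInverse.source :=
    hf'.localInverse_contMDiffOn.continuousOn
  have hW : IsOpen (hf'.localInverse.source ∩ hf'.localInverse ⁻¹' s) :=
    hcont.isOpen_inter_preimage hf'.localInverse_open_source hs
  have hpW : f p ∈ hf'.localInverse.source ∩ hf'.localInverse ⁻¹' s := by
    refine ⟨hf'.localInverse_mem_source, ?_⟩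
    show hf'.localInverse (f p) ∈ s
    rw [hf'.localInverse_left_inv hf'.localInverse_mem_target]
    exact hp
  filter_upwards [hW.mem_nhds hpW] with y hy
  obtain ⟨hy1, hy2⟩ := hy
  have hfy : f (hf'.localInverse y) = y := hf'.localInverse_right_inv hy1
  calc invFunOn f s y = invFunOn f s (f (hf'.localInverse y)) := by rw [hfy]
    _ = hf'.localInverse y := hinj.leftInvOn_invFunOn hy2

/-- **The inverse of an injective local diffeomorphism on an open set is `C^n` at the points of
the image.** [cite: LeeSmoothManifolds2013, Prop. 4.22] -/
theorem contMDiffAt_invFunOn (hf : IsLocalDiffeomorphOn I I' n f s) (hs : IsOpen s)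
    (hinj : InjOn f s) {p : A} (hp : p ∈ s) : ContMDiffAt I' I n (invFunOn f s) (f p) :=
  (hf ⟨p, hp⟩).localInverse_contMDiffAt.congr_of_eventuallyEq
    (invFunOn_eventuallyEq_localInverse hf hs hinj hp)

/-- The inverse is `C^n` at every point of `f '' s` (image form). [folklore] -/
theorem contMDiffAt_invFunOn_of_mem_image (hf : IsLocalDiffeomorphOn I I' n f s) (hs : IsOpen s)
    (hinj : InjOn f s) {y : N} (hy : y ∈ f '' s) : ContMDiffAt I' I n (invFunOn f s) y := by
  obtain ⟨p, hp, rfl⟩ := hy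
  exact contMDiffAt_invFunOn hf hs hinj hp

/-- **`d(f⁻¹)_{f p} ∘ df_p = id`** for the inverse on `s`. [folklore] -/
theorem mfderiv_invFunOn_apply_mfderiv (hf : IsLocalDiffeomorphOn I I' n f s) (hs : IsOpen s)
    (hinj : InjOn f s) (hn : n ≠ 0) {p : A} (hp : p ∈ s) (v : TangentSpace I p) :
    mfderiv I' I (invFunOn f s) (f p) (mfderiv I I' f p v) = v := by
  have hf' : IsLocalDiffeomorphAt I I' n f p := hf ⟨p, hp⟩
  rw [(invFunOn_eventuallyEq_localInverse hf hs hinj hp).mfderiv_eq]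
  have h : (mfderiv I' I hf'.localInverse (f p)).comp (mfderiv I I' f p) =
      ContinuousLinearMap.id ℝ (TangentSpace I p) := by
    rw [← mfderiv_id, ← hf'.localInverse_eventuallyEq_left.mfderiv_eq]
    exact (mfderiv_comp _ (hf'.localInverse_mdifferentiableAt hn) (hf'.mdifferentiableAt hn)).symm
  exact congrArg (fun L : TangentSpace I p →L[ℝ] TangentSpace I p => L v) h

/-- **`df_p ∘ d(f⁻¹)_{f p} = id`** for the inverse on `s`. [folklore] -/
theorem mfderiv_apply_mfderiv_invFunOn (hf : IsLocalDiffeomorphOn I I' n f s) (hs : IsOpen s)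
    (hinj : InjOn f s) (hn : n ≠ 0) {p : A} (hp : p ∈ s) (w : TangentSpace I' (f p)) :
    mfderiv I I' f p (mfderiv I' I (invFunOn f s) (f p) w) = w := by
  have hf' : IsLocalDiffeomorphAt I I' n f p := hf ⟨p, hp⟩
  rw [(invFunOn_eventuallyEq_localInverse hf hs hinj hp).mfderiv_eq]
  have hfx : MDifferentiableAt I I' f (hf'.localInverse (f p)) := by
    rw [hf'.localInverse_left_inv hf'.localInverse_mem_target]
    exact hf'.mdifferentiableAt hn
  have h : (mfderiv I I' f p).comp (mfderiv I' I hf'.localInverse (f p)) =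
      ContinuousLinearMap.id ℝ (TangentSpace I' (f p)) := by
    rw [← mfderiv_id, ← hf'.localInverse_eventuallyEq_right.mfderiv_eq,
      mfderiv_comp _ hfx (hf'.localInverse_mdifferentiableAt hn),
      hf'.localInverse_left_inv hf'.localInverse_mem_target]
  exact congrArg (fun L : TangentSpace I' (f p) →L[ℝ] TangentSpace I' (f p) => L w) h

/-- **`d(f⁻¹)_{f p}` is injective.** [folklore] -/
theorem mfderiv_invFunOn_eq_zero (hf : IsLocalDiffeomorphOn I I' n f s) (hs : IsOpen s)
    (hinj : InjOn f s) (hn : n ≠ 0) {p : A} (hp : p ∈ s) {w : TangentSpace I' (f p)}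
    (hw : mfderiv I' I (invFunOn f s) (f p) w = 0) : w = 0 := by
  have h := mfderiv_apply_mfderiv_invFunOn hf hs hinj hn hp w
  rw [hw] at h
  exact h.symm.trans (map_zero _)

/-- **`df_p` is injective.** [folklore] -/
theorem mfderiv_eq_zero_of_locDiff (hf : IsLocalDiffeomorphOn I I' n f s) (hs : IsOpen s)
    (hinj : InjOn f s) (hn : n ≠ 0) {p : A} (hp : p ∈ s) {v : TangentSpace I p}
    (hv : mfderiv I I' f p v = 0) : v = 0 := by
  have h := mfderiv_invFunOn_apply_mfderiv hf hs hinj hn hp v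
  rw [hv] at h
  exact h.symm.trans (map_zero _)

/-- **Holomorphy passes to the inverse**: if `df_p` intertwines an endomorphism `I₀` of `T_p A`
with an endomorphism `J₀` of `T_{f p} N` (`J₀ ∘ df_p = df_p ∘ I₀`), then `d(f⁻¹)_{f p}` intertwines
`J₀` with `I₀`. [folklore] -/
theorem mfderiv_invFunOn_conj (hf : IsLocalDiffeomorphOn I I' n f s) (hs : IsOpen s)
    (hinj : InjOn f s) (hn : n ≠ 0) {p : A} (hp : p ∈ s)
    (I₀ : TangentSpace I p → TangentSpace I p)
    (J₀ : TangentSpace I' (f p) → TangentSpace I' (f p))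
    (hJ : ∀ q : TangentSpace I p, J₀ (mfderiv I I' f p q) = mfderiv I I' f p (I₀ q))
    (ξ : TangentSpace I' (f p)) :
    mfderiv I' I (invFunOn f s) (f p) (J₀ ξ) = I₀ (mfderiv I' I (invFunOn f s) (f p) ξ) := by
  have h1 := mfderiv_apply_mfderiv_invFunOn hf hs hinj hn hp ξ
  calc mfderiv I' I (invFunOn f s) (f p) (J₀ ξ)
      = mfderiv I' I (invFunOn f s) (f p)
          (J₀ (mfderiv I I' f p (mfderiv I' I (invFunOn f s) (f p) ξ))) := by rw [h1]
    _ = mfderiv I' I (invFunOn f s) (f p)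
          (mfderiv I I' f p (I₀ (mfderiv I' I (invFunOn f s) (f p) ξ))) := by rw [hJ]
    _ = I₀ (mfderiv I' I (invFunOn f s) (f p) ξ) :=
          mfderiv_invFunOn_apply_mfderiv hf hs hinj hn hp _

omit [Nonempty A] in
/-- The image `f '' s` of the open set `s` under the local diffeomorphism is a neighbourhood of
each of its points. [folklore] -/
theorem image_mem_nhds_of_locDiff (hf : IsLocalDiffeomorphOn I I' n f s) (hs : IsOpen s)
    {p : A} (hp : p ∈ s) : f '' s ∈ 𝓝 (f p) := by
  have hf' : IsLocalDiffeomorphAt I I' n f p := hf ⟨p, hp⟩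
  have hcont : ContinuousOn hf'.localInverse hf'.localInverse.source :=
    hf'.localInverse_contMDiffOn.continuousOn
  have hW : IsOpen (hf'.localInverse.source ∩ hf'.localInverse ⁻¹' s) :=
    hcont.isOpen_inter_preimage hf'.localInverse_open_source hs
  have hpW : f p ∈ hf'.localInverse.source ∩ hf'.localInverse ⁻¹' s := by
    refine ⟨hf'.localInverse_mem_source, ?_⟩
    show hf'.localInverse (f p) ∈ s
    rw [hf'.localInverse_left_inv hf'.localInverse_mem_target]
    exact hp
  filter_upwards [hW.mem_nhds hpW] with y hy
  exact ⟨hf'.localInverse y, hy.2, hf'.localInverse_right_inv hy.1⟩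

end LocInv

/-! ## The two coordinate projections `ℝ⁴ → ℝ²` -/

/-- Model space `ℝ⁴ = ℂ²` (coordinates `0,1` = `z₁`, `2,3` = `z₂`). -/
local notation "E4" => EuclideanSpace ℝ (Fin 4)
/-- `ℝ² = ℂ`, the coordinate plane of one factor. -/
local notation "E2" => EuclideanSpace ℝ (Fin 2)

/-- `(q₀, q₁, q₂, q₃) ↦ (q₀, q₁)` as a linear map. [folklore] -/
def T01ₗ : E4 →ₗ[ℝ] E2 where
  toFun q := WithLp.toLp 2 ![q 0, q 1]
  map_add' q q' := by
    ext i; fin_cases i <;> simp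
  map_smul' c q := by
    ext i; fin_cases i <;> simp

/-- `(q₀, q₁, q₂, q₃) ↦ (q₂, q₃)` as a linear map. [folklore] -/
def T23ₗ : E4 →ₗ[ℝ] E2 where
  toFun q := WithLp.toLp 2 ![q 2, q 3]
  map_add' q q' := by
    ext i; fin_cases i <;> simp
  map_smul' c q := by
    ext i; fin_cases i <;> simp

/-- **The `z₁`-coordinate `ℝ⁴ → ℝ²`** as a continuous linear map. [folklore] -/
def T01 : E4 →L[ℝ] E2 := LinearMap.toContinuousLinearMap T01ₗ

/-- **The `z₂`-coordinate `ℝ⁴ → ℝ²`** as a continuous linear map. [folklore] -/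
def T23 : E4 →L[ℝ] E2 := LinearMap.toContinuousLinearMap T23ₗ

/-- `T01 q = (q₀, q₁)`. [folklore] -/
theorem T01_apply (q : E4) : T01 q = WithLp.toLp 2 ![q 0, q 1] := rfl

/-- `T23 q = (q₂, q₃)`. [folklore] -/
theorem T23_apply (q : E4) : T23 q = WithLp.toLp 2 ![q 2, q 3] := rfl

/-- Coordinates of `P01 a + P23 b`. [folklore] -/
theorem P01_add_P23_apply (a b : E4) :
    (CapModel.P01 a + CapModel.P23 b) 0 = a 0 ∧ (CapModel.P01 a + CapModel.P23 b) 1 = a 1 ∧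
      (CapModel.P01 a + CapModel.P23 b) 2 = b 2 ∧ (CapModel.P01 a + CapModel.P23 b) 3 = b 3 := by
  simp [CapModel.P01_apply, CapModel.P23_apply]

/-- `P01 a = 0` iff `a₀ = a₁ = 0`. [folklore] -/
theorem P01_eq_zero_iff (a : E4) : CapModel.P01 a = 0 ↔ a 0 = 0 ∧ a 1 = 0 := by
  constructor
  · intro h
    have h0 := congrArg (fun q : E4 => q 0) h
    have h1 := congrArg (fun q : E4 => q 1) h
    simp [CapModel.P01_apply] at h0 h1
    exact ⟨h0, h1⟩
  · rintro ⟨h0, h1⟩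
    ext i; fin_cases i <;> simp [CapModel.P01_apply, h0, h1]

/-- `P23 a = 0` iff `a₂ = a₃ = 0`. [folklore] -/
theorem P23_eq_zero_iff (a : E4) : CapModel.P23 a = 0 ↔ a 2 = 0 ∧ a 3 = 0 := by
  constructor
  · intro h
    have h2 := congrArg (fun q : E4 => q 2) h
    have h3 := congrArg (fun q : E4 => q 3) h
    simp [CapModel.P23_apply] at h2 h3
    exact ⟨h2, h3⟩
  · rintro ⟨h2, h3⟩
    ext i; fin_cases i <;> simp [CapModel.P23_apply, h2, h3]

/-- A vector with `P01 a = 0` and `P23 a = 0` vanishes. [folklore] -/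
theorem eq_zero_of_P01_P23 {a : E4} (h01 : CapModel.P01 a = 0) (h23 : CapModel.P23 a = 0) :
    a = 0 := by
  rw [P01_eq_zero_iff] at h01
  rw [P23_eq_zero_iff] at h23
  ext i; fin_cases i
  · simpa using h01.1
  · simpa using h01.2
  · simpa using h23.1
  · simpa using h23.2

/-- **The area identity behind tameness**: `dx₀∧dx₁ (a, α a + β I4 a) = β (a₀² + a₁²)` and the
same for `dx₂∧dx₃`, so `ω₀ (P01 a + P23 b, P01 (α a + β I4 a) + P23 (α' b + β' I4 b))
= β (a₀² + a₁²) + β' (b₂² + b₃²)`. [folklore] -/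
theorem stdSymplecticForm_split (a b : E4) (α β α' β' : ℝ) :
    Literature.Geometry.Symplectic.stdSymplecticForm (CapModel.P01 a + CapModel.P23 b)
        (CapModel.P01 (α • a + β • CapModel.I4 a) + CapModel.P23 (α' • b + β' • CapModel.I4 b)) =
      β * (a 0 ^ 2 + a 1 ^ 2) + β' * (b 2 ^ 2 + b 3 ^ 2) := by
  simp [Literature.Geometry.Symplectic.stdSymplecticForm, CapModel.P01_apply, CapModel.P23_apply,
    CapModel.I4_apply]
  ring

end ReadSigma

/-- **Registered helper sub-goal `helper_readSigmaLocInvSmooth`** (first auxiliary file of stub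
`stub_readSigma`): the inverse `Function.invFunOn f s` of a map `f : ℝ⁴ → X` which is an injective
`C^∞` local diffeomorphism on an open set `s` is `C^∞` at every point `f p`, `p ∈ s`.
[cite: LeeSmoothManifolds2013, Prop. 4.22] -/
theorem helper_readSigmaLocInvSmooth : ∀ (X : Type) [TopologicalSpace X]
    [ChartedSpace (EuclideanSpace ℝ (Fin 4)) X] (f : EuclideanSpace ℝ (Fin 4) → X)
    (s : Set (EuclideanSpace ℝ (Fin 4))),
    IsLocalDiffeomorphOn 𝓘(ℝ, EuclideanSpace ℝ (Fin 4)) (𝓡 4) ∞ f s → IsOpen s → Set.InjOn f s →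
    ∀ p ∈ s, ContMDiffAt (𝓡 4) 𝓘(ℝ, EuclideanSpace ℝ (Fin 4)) ∞ (Function.invFunOn f s) (f p) :=
  fun _ _ _ _ _ hf hs hinj _ hp => ReadSigma.contMDiffAt_invFunOn hf hs hinj hp

end Summit.SmoothPoincare4.SmoothPoincare4.Theorems.GromovRecognitionRelEnd.CrossCapLaurent

end
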